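import Summits.Ventures.PercRepro.RankLevelSetHallRuleL

/-!
# PercRepro — THE COLOOP-SHARE KERNEL (RULE CS): ITS LOADS ARE EXACTLY ONE (p4, gen 37; paper proofs/P4-CRUX-K2.md,
Lemma 1; C-044, UP form, tight layer `#E = 2q + 2`, `k = 2`)

At the tight layer with `p = q + 2` the `Y`-sets are the sets `S` of rank `q + 1` (of ANY size `≥ q + 1`).  A **used
coloop** of `S` is an `x ∈ S` with `r(S ∖ {x}) = q` such that `S ∖ {x}` contains a member (`usedColoops`); the
**member-bases** of a set `R` are the members inside it (`memberBases`).  The **coloop-share weight** of a member `Z`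
inside `S` is `1 / (ℓ(S) · b(S ∩ cl Z))` when `S ∖ cl Z` is a single element `o` (then `o` is a used coloop of `S` and
`S ∩ cl Z = S ∖ {o}`), and `0` otherwise — `S` splits one unit evenly among its used coloops `u`, and the share of `u`
evenly among the member-bases of `S ∖ {u}`.  THIS FILE: the weight is non-negative, supported on `Z ⊆ S`, and
**every `Y`-set is loaded at most `1`** (`csWeight_load_le_one`): the members of `S` with positive weight are
partitioned by their unique outside element `u ∈ usedColoops S`, the class of `u` being the `b(S ∖ {u})` member-bases
of `S ∖ {u}`.  The receipts (every member gets at least `Φ(p,q) = (q+2)/(q+1)`) and the Hall bound are in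
`RankLevelSetHallCoopShareReceipt`.

* `usedColoops`, `memberBases`, `csWeight`;
* `eRk_eq_of_mem_cellY_k2` — a `Y`-set of the cell `(q+2, q)` has rank exactly `q + 1`;
* `sdiff_closure_eq_singleton_of_subset` — a member inside `S ∖ {u}` (`u` a used coloop) has `S ∖ cl Z = {u}`;
* `csWeight_nonneg`, `subset_of_csWeight_ne_zero`, **`csWeight_load_le_one`**.
Axioms: standard.
-/

namespace PercRepro

open Set Matroid Finset

variable {α : Type} (M : Matroid α) [M.Finite]

/-- The **used coloops** of `S`: the `x ∈ S` with `r(S ∖ {x}) = q` such that `S ∖ {x}` contains a member of the cell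
`(q + 2, q)`. -/
def usedColoops (q : ℕ) (S : Set α) : Set α :=
  {x | x ∈ S ∧ M.eRk (S \ {x}) = (q : ℕ∞) ∧ ∃ Z ∈ cellMembers M (q + 2) q, Z ⊆ S \ {x}}

/-- The **member-bases** of `R`: the members of the cell `(q + 2, q)` inside `R`. -/
def memberBases (q : ℕ) (R : Set α) : Set (Set α) :=
  {Z | Z ∈ cellMembers M (q + 2) q ∧ Z ⊆ R}

/-- The **coloop-share weight** of the member `Z` at the `Y`-set `S`: `1 / (ℓ(S) · b(S ∩ cl Z))` when `S ∖ cl Z` is a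
single element, `0` otherwise. -/
noncomputable def csWeight (q : ℕ) (Z S : Set α) : ℚ := by
  classical
  exact if Z ∈ cellMembers M (q + 2) q ∧ S ∈ cellY M (q + 2) q ∧ Z ⊆ S ∧ (S \ M.closure Z).ncard = 1 then
    1 / (((usedColoops M q S).ncard : ℚ) * ((memberBases M q (S ∩ M.closure Z)).ncard : ℚ))
  else 0

omit [M.Finite] in
/-- The used coloops of `S` lie in `S`. -/
theorem usedColoops_subset (q : ℕ) (S : Set α) : usedColoops M q S ⊆ S := fun _ hx => hx.1

omit [M.Finite] in
/-- The member-bases of `R` are members. -/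
theorem memberBases_subset (q : ℕ) (R : Set α) : memberBases M q R ⊆ cellMembers M (q + 2) q :=
  fun _ hZ => hZ.1

/-- The member-bases of a set form a finite family. -/
theorem memberBases_finite (q : ℕ) (R : Set α) : (memberBases M q R).Finite :=
  (cellMembers_finite M (q + 2) q).subset (memberBases_subset M q R)

/-- The used coloops of a set form a finite set. -/
theorem usedColoops_finite (q : ℕ) (S : Set α) (hS : S ⊆ M.E) : (usedColoops M q S).Finite :=
  (M.set_finite S hS).subset (usedColoops_subset M q S)

omit [M.Finite] in
/-- A member has rank `q`. -/
theorem eRk_eq_of_mem_cellMembers (q : ℕ) {Z : Set α} (hZ : Z ∈ cellMembers M (q + 2) q) :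
    M.eRk Z = (q : ℕ∞) := hZ.2.1

omit [M.Finite] in
/-- A `Y`-set of the cell `(q + 2, q)` has rank exactly `q + 1`. -/
theorem eRk_eq_of_mem_cellY_k2 (q : ℕ) {S : Set α} (hS : S ∈ cellY M (q + 2) q) :
    M.eRk S = ((q + 1 : ℕ) : ℕ∞) := by
  obtain ⟨-, h1, h2⟩ := hS
  have hlt : M.eRk S < ⊤ := lt_of_lt_of_le h2 le_top
  obtain ⟨n, hn⟩ := ENat.ne_top_iff_exists.1 hlt.ne
  rw [← hn] at h1 h2 ⊢
  have h1' : q < n := by exact_mod_cast h1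
  have h2' : n < q + 2 := by exact_mod_cast h2
  have : n = q + 1 := by omega
  rw [this]

omit [M.Finite] in
/-- A `Y`-set of the cell `(q + 2, q)` has rank `q + 1` (as `(q : ℕ∞) + 1`). -/
theorem eRk_eq_of_mem_cellY_k2' (q : ℕ) {S : Set α} (hS : S ∈ cellY M (q + 2) q) :
    M.eRk S = (q : ℕ∞) + 1 := by
  rw [eRk_eq_of_mem_cellY_k2 M q hS]
  push_cast
  rfl

/-- **A member inside `S ∖ {u}`, `u` a used coloop, has `S ∖ cl Z = {u}`**: `S ∖ {u}` lies in `cl Z` (same rank `q`),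
and `u ∉ cl Z` since `r(S) = q + 1`. -/
theorem sdiff_closure_eq_singleton_of_subset (q : ℕ) {S Z : Set α} (hS : S ∈ cellY M (q + 2) q)
    (hZ : Z ∈ cellMembers M (q + 2) q) {u : α} (hu : u ∈ usedColoops M q S) (hZu : Z ⊆ S \ {u}) :
    S \ M.closure Z = {u} := by
  obtain ⟨huS, hru, -⟩ := hu
  have hZE : Z ⊆ M.E := hZ.1
  have hSE : S ⊆ M.E := hS.1
  -- cl (S ∖ {u}) = cl Z
  have hcl : M.closure Z = M.closure (S \ {u}) := by
    apply (M.isRkFinite_of_finite (M.set_finite Z hZE)).closure_eq_closure_of_subset_of_eRk_ge_eRk hZu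
    rw [hru, eRk_eq_of_mem_cellMembers M q hZ]
  have hsub : S \ {u} ⊆ M.closure Z := by
    rw [hcl]
    exact M.subset_closure _ (sdiff_subset.trans hSE)
  -- u ∉ cl Z
  have hu_not : u ∉ M.closure Z := by
    intro hmem
    have hS_sub : S ⊆ M.closure Z := by
      intro x hx
      by_cases hxu : x = u
      · rw [hxu]; exact hmem
      · exact hsub ⟨hx, hxu⟩
    have h1 : M.eRk S ≤ M.eRk (M.closure Z) := M.eRk_mono hS_sub
    rw [M.eRk_closure_eq, eRk_eq_of_mem_cellMembers M q hZ, eRk_eq_of_mem_cellY_k2 M q hS] at h1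
    have : q + 1 ≤ q := by exact_mod_cast h1
    omega
  ext x
  constructor
  · rintro ⟨hxS, hxcl⟩
    by_contra hxu
    exact hxcl (hsub ⟨hxS, hxu⟩)
  · intro hx
    rw [Set.mem_singleton_iff] at hx
    rw [hx]
    exact ⟨huS, hu_not⟩

omit [M.Finite] in
/-- With `S ∖ cl Z = {u}`, the set `S ∩ cl Z` is `S ∖ {u}`. -/
theorem inter_closure_eq_sdiff_of_sdiff_eq (S Z : Set α) {u : α} (h : S \ M.closure Z = {u}) :
    S ∩ M.closure Z = S \ {u} := by
  ext x
  constructor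
  · rintro ⟨hxS, hxcl⟩
    refine ⟨hxS, ?_⟩
    intro hxu
    rw [Set.mem_singleton_iff] at hxu
    have : u ∈ S \ M.closure Z := by rw [h]; exact Set.mem_singleton u
    rw [← hxu] at this
    exact this.2 hxcl
  · rintro ⟨hxS, hxu⟩
    refine ⟨hxS, ?_⟩
    by_contra hxcl
    have : x ∈ S \ M.closure Z := ⟨hxS, hxcl⟩
    rw [h, Set.mem_singleton_iff] at this
    exact hxu (by rw [Set.mem_singleton_iff]; exact this)

omit [M.Finite] in
/-- The weight is non-negative. -/
theorem csWeight_nonneg (q : ℕ) (Z S : Set α) : 0 ≤ csWeight M q Z S := by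
  classical
  unfold csWeight
  split_ifs
  · positivity
  · exact le_rfl

omit [M.Finite] in
/-- The weight is supported on the pairs `Z ⊆ S`. -/
theorem subset_of_csWeight_ne_zero (q : ℕ) (Z S : Set α) (h : csWeight M q Z S ≠ 0) : Z ⊆ S := by
  classical
  unfold csWeight at h
  split_ifs at h with hc
  · exact hc.2.2.1
  · exact absurd rfl h

/-- The weight of a member `Z ⊆ S ∖ {u}` at `S`, for a used coloop `u`: `1 / (ℓ(S) · b(S ∖ {u}))`. -/
theorem csWeight_eq_of_subset (q : ℕ) {S Z : Set α} (hS : S ∈ cellY M (q + 2) q)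
    (hZ : Z ∈ cellMembers M (q + 2) q) {u : α} (hu : u ∈ usedColoops M q S) (hZu : Z ⊆ S \ {u}) :
    csWeight M q Z S
      = 1 / (((usedColoops M q S).ncard : ℚ) * ((memberBases M q (S \ {u})).ncard : ℚ)) := by
  classical
  have h1 := sdiff_closure_eq_singleton_of_subset M q hS hZ hu hZu
  have h2 := inter_closure_eq_sdiff_of_sdiff_eq M S Z h1
  unfold csWeight
  rw [if_pos ⟨hZ, hS, hZu.trans sdiff_subset, by rw [h1, Set.ncard_singleton]⟩, h2]

omit [M.Finite] in
/-- If the weight of `Z` at `S` is non-zero then `Z` lies inside `S ∖ {u}` for a used coloop `u`. -/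
theorem exists_usedColoop_of_csWeight_ne_zero (q : ℕ) {S Z : Set α} (h : csWeight M q Z S ≠ 0) :
    ∃ u ∈ usedColoops M q S, Z ⊆ S \ {u} := by
  classical
  unfold csWeight at h
  split_ifs at h with hc
  · obtain ⟨hZ, hS, hZS, hcard⟩ := hc
    obtain ⟨o, ho⟩ := Set.ncard_eq_one.1 hcard
    have hoS : o ∈ S \ M.closure Z := by rw [ho]; exact Set.mem_singleton o
    have hZo : Z ⊆ S \ {o} := by
      intro x hx
      refine ⟨hZS hx, ?_⟩
      intro hxo
      rw [Set.mem_singleton_iff] at hxo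
      rw [hxo] at hx
      exact hoS.2 (M.subset_closure Z hZ.1 hx)
    refine ⟨o, ⟨hoS.1, ?_, Z, hZ, hZo⟩, hZo⟩
    -- r(S ∖ {o}) = q: S ∖ {o} = S ∩ cl Z ⊆ cl Z and Z ⊆ S ∖ {o}
    have hinter := inter_closure_eq_sdiff_of_sdiff_eq M S Z ho
    apply le_antisymm
    · rw [← hinter]
      calc M.eRk (S ∩ M.closure Z) ≤ M.eRk (M.closure Z) := M.eRk_mono inter_subset_right
        _ = (q : ℕ∞) := by rw [M.eRk_closure_eq, eRk_eq_of_mem_cellMembers M q hZ]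
    · rw [← eRk_eq_of_mem_cellMembers M q hZ]
      exact M.eRk_mono hZo
  · exact absurd rfl h

/-- A member lies inside `S ∖ {u}` for at most one used coloop `u` of `S`. -/
theorem usedColoop_unique (q : ℕ) {S Z : Set α} (hS : S ∈ cellY M (q + 2) q)
    (hZ : Z ∈ cellMembers M (q + 2) q) {u u' : α} (hu : u ∈ usedColoops M q S) (hZu : Z ⊆ S \ {u})
    (hu' : u' ∈ usedColoops M q S) (hZu' : Z ⊆ S \ {u'}) : u = u' := by
  have h1 := sdiff_closure_eq_singleton_of_subset M q hS hZ hu hZu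
  have h2 := sdiff_closure_eq_singleton_of_subset M q hS hZ hu' hZu'
  rw [h1] at h2
  exact Set.singleton_eq_singleton_iff.1 h2

/-- **Every `Y`-set is loaded at most `1`**: the members of `S` with positive weight are partitioned by their used
coloop `u`, each class of size `b(S ∖ {u})`, each paying `1 / (ℓ(S) b(S ∖ {u}))`. -/
theorem csWeight_load_le_one (q : ℕ) {S : Set α} (hS : S ∈ cellY M (q + 2) q) :
    ∑ Z ∈ (cellMembers_finite M (q + 2) q).toFinset, csWeight M q Z S ≤ 1 := by
  classical
  set Mf : Finset (Set α) := (cellMembers_finite M (q + 2) q).toFinset with hMf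
  have hmemM : ∀ Z, Z ∈ Mf ↔ Z ∈ cellMembers M (q + 2) q := fun Z => by
    rw [hMf, (cellMembers_finite M (q + 2) q).mem_toFinset]
  set Uf : Finset α := (usedColoops_finite M q S hS.1).toFinset with hUf
  have hmemU : ∀ u, u ∈ Uf ↔ u ∈ usedColoops M q S := fun u => by
    rw [hUf, (usedColoops_finite M q S hS.1).mem_toFinset]
  have hUcard : Uf.card = (usedColoops M q S).ncard := by
    rw [hUf, ← ncard_eq_toFinset_card _ (usedColoops_finite M q S hS.1)]
  -- the weight of `Z` is the sum over `u ∈ Uf` of its class indicator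
  have hpt : ∀ Z ∈ Mf, csWeight M q Z S
      = ∑ u ∈ Uf, (if Z ⊆ S \ {u} then
          1 / (((usedColoops M q S).ncard : ℚ) * ((memberBases M q (S \ {u})).ncard : ℚ)) else 0) := by
    intro Z hZ
    rw [hmemM] at hZ
    by_cases hex : ∃ u ∈ usedColoops M q S, Z ⊆ S \ {u}
    · obtain ⟨u, hu, hZu⟩ := hex
      rw [csWeight_eq_of_subset M q hS hZ hu hZu]
      rw [Finset.sum_eq_single u]
      · rw [if_pos hZu]
      · intro u' hu' hne
        rw [hmemU] at hu'
        rw [if_neg]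
        intro hZu'
        exact hne (usedColoop_unique M q hS hZ hu' hZu' hu hZu)
      · intro hnot
        exact absurd ((hmemU u).2 hu) hnot
    · have h0 : csWeight M q Z S = 0 := by
        by_contra hne
        exact hex (exists_usedColoop_of_csWeight_ne_zero M q hne)
      rw [h0]
      symm
      apply Finset.sum_eq_zero
      intro u hu
      rw [hmemU] at hu
      rw [if_neg]
      intro hZu
      exact hex ⟨u, hu, hZu⟩
  rw [Finset.sum_congr rfl hpt, Finset.sum_comm]
  -- the class of `u` has exactly `b(S ∖ {u})` members
  have hclass : ∀ u ∈ Uf, (∑ Z ∈ Mf, (if Z ⊆ S \ {u} then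
      1 / (((usedColoops M q S).ncard : ℚ) * ((memberBases M q (S \ {u})).ncard : ℚ)) else 0))
      = 1 / ((usedColoops M q S).ncard : ℚ) := by
    intro u hu
    rw [hmemU] at hu
    rw [Finset.sum_ite, Finset.sum_const_zero, add_zero, Finset.sum_const, nsmul_eq_mul]
    have hcount : ((Mf.filter (fun Z => Z ⊆ S \ {u})).card : ℚ) = ((memberBases M q (S \ {u})).ncard : ℚ) := by
      have heq : memberBases M q (S \ {u}) = ((Mf.filter (fun Z => Z ⊆ S \ {u}) : Finset (Set α)) : Set (Set α)) := by
        ext Z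
        rw [Finset.coe_filter, Set.mem_setOf_eq, hmemM]
        rfl
      rw [heq, ncard_coe_finset]
    have hpos : (0 : ℚ) < ((memberBases M q (S \ {u})).ncard : ℚ) := by
      obtain ⟨-, -, Z, hZ, hZu⟩ := hu
      have hne : (memberBases M q (S \ {u})).Nonempty := ⟨Z, hZ, hZu⟩
      have := (Set.ncard_pos (memberBases_finite M q (S \ {u}))).2 hne
      exact_mod_cast this
    rw [hcount]
    field_simp
  rw [Finset.sum_congr rfl hclass, Finset.sum_const, nsmul_eq_mul, hUcard]
  by_cases hU : (usedColoops M q S).ncard = 0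
  · rw [hU]; simp
  · have hpos : (0 : ℚ) < ((usedColoops M q S).ncard : ℚ) := by
      exact_mod_cast Nat.pos_of_ne_zero hU
    rw [mul_one_div, div_self hpos.ne']

end PercRepro
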